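import Literature.MathematicalPhysics.QuantumFieldTheory.Balaban1983to89.B9Thm32CinvAtKnitLetterOfCubeData

/-!
# `Balaban1983to89.B9Thm31GpAtKnitLetterOfCubeData` — [B9] THEOREM 3.1 (3.42)₁ FOR `G′(U)` AT PRINT's KNIT LETTER `parKnitY`, AT A `U(N)`-VALUED (3.35)-REGULAR
# BACKGROUND OF [B7]'s CLASS (52), FOR EVERY MEMBER ABOVE ONE THRESHOLD, FROM THE SAME PER-CUBE (3.35) DATA AS FILES 9–11 — the `G′`-line companion of FILE 11:
# FILE 9 (the (3.42) block of `G′` at def-Y's letter) + D1's READ + junction file 9 in print's units, the located smallness discharged by an admissible size `a₀` of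
# `α₀′` (module M5.1b-G‴ FILE 12, sub-row G-B9-LETTERS; seat p33; consumer: the knit assembler's `hGm` binder, from the E2-6 datum family of `hC`)

statement-level skeleton of published theorems with citation tags; proofs where landed; nothing here is a claim about the
Yang–Mills mass gap

T. Bałaban, *Propagators for lattice gauge theories in a background field*, Commun. Math. Phys. **99** (1985) 389–434 [`Balaban1985BackgroundPropagators`,
"[B9]"]; T. Bałaban, *Propagators and renormalization transformations for lattice gauge theories. II*, Commun. Math. Phys. **96** (1984) 223–250
[`Balaban1984PropagatorsII`, "[4]"]; T. Bałaban, *Averaging operations for lattice gauge theories*, Commun. Math. Phys. **98** (1985) 17–51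
[`Balaban1985Averaging`, "[B7]"].

THE PRINT.  [B9] Thm 3.1 (3.42) p. 397 («|G′(U; x, x′)| ≦ O(1)(Lʲη)²exp(−δd)» — first member), (3.19) p. 393 (the knit letter «(52), (53) in [5]»), Cor. 3.6 p. 408, Thm 3.7
pp. 409–410 («expansions … convergent in all norms»), Thm 3.11 p. 416; [4] Prop. 2.2 (2.50)–(2.51) p. 232, (2.66)–(2.67) p. 234; [B7] (52)–(53) pp. 26–27 («α₀
sufficiently small»).

WHY THIS FILE ∕ THE ARGUMENT.  The knit consumer's `hGm : conj b(η²G′(U; parKnitY)) ≺ A·ℓ(a)²·e^{−δd}` (site carrier `(z, j) ↦ ιB(Δ z)`; RECORD-JB-g95) is supplied by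
junction file 15 from M5.5's Theorem-3.7 data; FILE 11 supplies `hC` from the E2-6 per-cube (3.35) datum family.  THIS FILE supplies `hGm` from that SAME family, so
the assembler quantifies over ONE data family: FILE 9's block `EBlock(… G′(U; parSymY) …) K_G δ_G` ⟶ D1's `hasMajorant_conj_G_of_eBlockInv` (`A_s = M₂Σ‖b‖K_G`, rate
`δ_G`) ⟶ FILE 11's `hasMajorant_conj_GpY_parKnitY_print` (junction file 9 at `η = etaS`, `P = ℓ² ≤ 1`, `α = ½`) under the located smallness `α₀′Φ₁ ≤ ½`,
`Φ₁ = 32(d+1)²M₂Σ‖b‖A_sc₁(δ_G, ½)`, discharged by `α₀′ ≤ a₀ := 1∕(2(Φ₁+1))` (FILE 11's `small_of_le`); geometry by FILE 11's `geo_ladder` at `r = δ_G`.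

CITATION HEADER (lean-in-tree rule).  Cell `lit-balaban`, sub-row G-B9-LETTERS, module M5.1b-G‴ FILE 12 → seat `lit-balaban-p33` gen 98.  REUSED BY NAME: FILE 9
`B9Cor36GpCoverBindersUnitary.eBlock_GpY_of_cubeData_unitary`, FILE 11 `B9Thm32CinvAtKnitLetterOfCubeData.{geo_ladder, small_of_le, hasMajorant_conj_GpY_parKnitY_print}`,
D1 `B9CubeLettersInvReadDict.hasMajorant_conj_G_of_eBlockInv`, `B9Thm37GpAtCoverLarge.geo9K_M_eq'`.

WHAT THIS FILE PROVES (sorry-free; no definitions).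
* ★★★ **`gp_at_knit_member_of_cubeData_unitary`** — for `G ≤ U(N)` averaging-closed, `N ≥ 1`, `(Rr, Hp)`, a real basis `b` with coordinate bound `M₂`, `ℓ ≥ 1`: there are
  `δ > 0`, `K ≥ 0`, thresholds `M₀, T₀, N₀`, `a₁ > 0` and `a₀ > 0` such that for every `0 < α₀′ ≤ a₀` with `C₀α₀′ ≤ ⅓`, `2α₀′ ≤ c₂′`, every member above the thresholds
  with `c_f = L^k`, every section `ιB`, every `G`-valued `U` with `pdev (liftCfg U) < α₀′(L^k)⁻²`, every family of per-cube (3.35) data (FILE 9's eleven hypotheses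
  verbatim) and every background family through `U`: `conj b(η²·G′(U; parKnitY)) ≺ K·ℓ(a)²·e^{−δ·d(a,a′)}` on `(z, j) ↦ ιB(Δ z)` — the knit consumer's `hGm`, token-identical.
  DESIGN CONSTANTS (not printed constants): `K = 2·(M₂Σ‖b‖K_G)·c₁(δ_G, ½)`, `δ = δ_G∕2`; `a₀ = 1∕(2(Φ₁+1))` depends on `d`, `M₂Σ_j‖b_j‖`, FILE 9's `K_G`, `δ_G` and the
  (2.61) constant `c₁(δ_G, ½)` of the member family — on nothing else.

HONEST SCOPE.  Composition of landed results above thresholds; the class-(52) size `a₀` realises [B7]'s «α₀ sufficiently small» (explicit, unoptimised); the rate is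
halved once ([4] (2.66) at `α = ½`; «arbitrarily close» not pursued — DESIGN choice); `𝔸 = M_N(ℂ)`, `N ≥ 1`.  Count-neutral: (3.42)₁ at the knit letter is one INPUT
of [B8]'s readings; nothing of [B8] Thm 2 is asserted; nothing continuum, nothing about OS axioms or the mass gap.  No `sorry`, no `axiom`, no `… : Prop` fact, no
`instance`, no `notation`, no `def`.  NEW file; nothing landed is modified.  Net new unproved facts: 0.  Seat `lit-balaban-p33` gen 98, 2026-08-28.  RELATED, NOT
DUPLICATED (searched 2026-08-28: `lean search 'gp_at_knit|GpAtKnitLetterOfCubeData' --decl` = ∅): junction file 15 `B9B8KnitLetterE12FromM55.hasMajorant_conj_GpY_parKnitY_of_cubes`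
(same output shape from M5.5's Theorem-3.7 data — a different input family), junction file 9 (the transfer, used by name through FILE 11).
-/

noncomputable section

open scoped BigOperators Matrix Matrix.Norms.L2Operator

namespace Literature.MathematicalPhysics.QuantumFieldTheory.Balaban1983to89.B9Thm31GpAtKnitLetterOfCubeData

open B4PartitionUnity22 (thetaProf D1)
open B9Eq39Adjoint (fluct covD)
open B6Geom246MultiLevelBox (blkOf)
open B6KLevelCensusIndexV1 (KIdx kGeo)
open B6Cover236MultiLevelBlocks (cubes)
open B6GlobalChartV1 (PV boxEquiv)
open B6Ineq2142KLevelV1 (β)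
open B6RandomWalk (HasMajorant c1_nonneg)
open B9BackgroundsKLevelV1 (shiftsV1)
open B9Eq352DivFormLetters (conj)
open B9Eq360DeltaPrimeAY (AfldY)
open B9CubeGeometryInputs (RM1)
open B9GeoNormsKLevelV1 (geo9K)
open B9Thm34Ext (toB6)
open B9CubeLettersInvReadDict (hasMajorant_conj_G_of_eBlockInv)
open B9Cor36CubeCutoffs (SC NearC)
open B9Cor36GpCoverBindersUnitary (eBlock_GpY_of_cubeData_unitary)
open B9Thm37GpAtCoverLarge (geo9K_M_eq')
open B9Thm32CinvAtKnitLetterOfCubeData (geo_ladder small_of_le hasMajorant_conj_GpY_parKnitY_print)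
open B7Prop2Explicit (AvgClosed pdev C0 c2' unitaryUnits)
open B9B8CarrierDictionary (liftCfg)
open B9B8AveragingJunction (parKnitY)
open Node00 (SiteY BlkY CfgY GaugeY IBondY toKT gaugeY parSymY GpY etaS)

variable {d ℓ : ℕ} {hd : 1 ≤ d + 1} {hL : Odd (ℓ + 1) ∧ 1 < ℓ + 1} {b₀ b₁ : ℝ}
variable {N : ℕ} {G : Subgroup (Matrix (Fin N) (Fin N) ℂ)ˣ}
variable {ι : Type} [Fintype ι] [DecidableEq ι] (b : Module.Basis ι ℝ (Matrix (Fin N) (Fin N) ℂ))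

/-- ★★★ **THEOREM 3.1 (3.42)₁ FOR `G′(U)` AT PRINT's KNIT LETTER, AT A `U(N)`-VALUED (3.35)-REGULAR BACKGROUND OF THE CLASS (52), FOR EVERY MEMBER ABOVE ONE THRESHOLD,
FROM THE PER-CUBE (3.35) DATA OF FILES 9–11** (FILE 9 + D1's READ + junction file 9 in print's units; located smallness discharged by `a₀`): for `G ≤ U(N)`
averaging-closed, `N ≥ 1`, `(Rr, Hp)`, a real basis `b` of `M_N(ℂ)` with coordinate bound `M₂`, there are `δ > 0`, `K ≥ 0`, thresholds `M₀, T₀, N₀`, `a₁ > 0` and `a₀ > 0`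
such that for every `0 < α₀′ ≤ a₀` with `C₀α₀′ ≤ ⅓`, `2α₀′ ≤ c₂′`, every member above the thresholds with `c_f = L^k`, every section `ιB`, every `G`-valued `U` with
`pdev (liftCfg U) < α₀′(L^k)⁻²`, every family of per-cube (3.35) data and every background family through `U`:
`conj b(η²·G′(U; parKnitY)) ≺ K·ℓ(a)²·e^{−δ·d(a,a′)}` on the site carrier `(z, j) ↦ ιB(Δ z)`.  DESIGN CONSTANTS (not printed): `K = 2(M₂Σ‖b‖K_G)c₁(δ_G,½)`, `δ = δ_G∕2`,
`a₀ = 1∕(2(Φ₁+1))`, `Φ₁ = 32(d+1)²(M₂Σ‖b‖)(M₂Σ‖b‖K_G)c₁(δ_G,½)` (depends on `d`, `M₂Σ‖b‖`, FILE 9's `K_G, δ_G`, the member family's (2.61) constant only).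
[cite: Balaban1985BackgroundPropagators, Thm 3.1 (3.42) p.397 + (3.19) p.393 + Cor. 3.6 p.408 + Thm 3.7 pp.409–410 + Thm 3.11 p.416; Balaban1984PropagatorsII, Prop. 2.2 (2.50)–(2.51) p.232 + (2.66)–(2.67) p.234; Balaban1985Averaging, (52)–(53) pp.26–27] -/
theorem gp_at_knit_member_of_cubeData_unitary [Nonempty (Fin N)] [∀ i' : KIdx d ℓ hd hL b₀ b₁, Fintype (geo9K i').Site]
    [∀ i' : KIdx d ℓ hd hL b₀ b₁, DecidableEq (geo9K i').Site] (hG : G ≤ unitaryUnits (Matrix (Fin N) (Fin N) ℂ)) (hGa : AvgClosed (d + 1) (ℓ + 1) G)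
    (Rr : KIdx d ℓ hd hL b₀ b₁ → ℝ) (Hp : KIdx d ℓ hd hL b₀ b₁ → Prop)
    (hℓ : 1 ≤ ℓ) {M₂ : ℝ} (hM₂ : 0 ≤ M₂) (hrepr : ∀ (v : Matrix (Fin N) (Fin N) ℂ) (j : ι), |b.repr v j| ≤ M₂ * ‖v‖) :
    ∃ δ K M₀ T₀ : ℝ, ∃ N₀ : ℕ, 0 < δ ∧ 0 ≤ K ∧ ∃ a₁ : ℝ, 0 < a₁ ∧ ∃ a₀ : ℝ, 0 < a₀ ∧
    ∀ (α₀' : ℝ), 0 < α₀' → α₀' ≤ a₀ → C0 (d + 1) * α₀' ≤ 1 / 3 → 2 * α₀' ≤ c2' (d + 1) (ℓ + 1) →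
    ∀ (i : KIdx d ℓ hd hL b₀ b₁),
      M₀ ≤ ((ℓ : ℝ) + 1) * (toKT i).Mh → N₀ + 1 ≤ (toKT i).R * ((ℓ + 1) * (toKT i).Mh) → T₀ ≤ RM1 i → i.cf = (((ℓ + 1 : ℕ) : ℝ)) ^ i.k →
    ∀ (ιB : BlkY i → IBondY i), (∀ s, β i.hN i.D i.hk (ιB s) = s) →
    ∀ (U : CfgY (Matrix (Fin N) (Fin N) ℂ) i), (∀ μ x, U μ x ∈ G) → pdev (liftCfg U) < α₀' * ((((ℓ + 1 : ℕ) : ℝ) ^ i.k)⁻¹) ^ 2 →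
    ∀ (g : ↥(cubes (toKT i).D.toDomains) → GaugeY (Matrix (Fin N) (Fin N) ℂ) i),
      (∀ c x, ‖(g c x : Matrix (Fin N) (Fin N) ℂ)‖ ≤ 1 ∧ ‖(((g c x)⁻¹ : (Matrix (Fin N) (Fin N) ℂ)ˣ) : Matrix (Fin N) (Fin N) ℂ)‖ ≤ 1) →
    ∀ (A : ↥(cubes (toKT i).D.toDomains) → AfldY (Matrix (Fin N) (Fin N) ℂ) i)
      (Q : ↥(cubes (toKT i).D.toDomains) → Set (Site (PV d ℓ i.m i.K hd hL) 0)) (C ξ Λ : ↥(cubes (toKT i).D.toDomains) → ℝ),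
      (∀ c, 0 ≤ C c) → (∀ c, 0 < ξ c) → (∀ c, 1 ≤ Λ c) → (∀ c, ξ c ≤ 5 * (SC i c : ℝ) * (kGeo i).eta) →
      (∀ c, LatticeNorms.scaleLen ((ℓ : ℝ) + 1) (kGeo i).eta (c.1.1 + 1) ≤ Λ c * ξ c) →
      (∀ c, ∀ x : Site (PV d ℓ i.m i.K hd hL) 0, NearC i c (35 * SC i c / 8 + 1) (boxEquiv i.hN x).1 → x ∈ Q c) →
      (∀ c, ∀ (κ : Fin (d + 1)) (x : Site (PV d ℓ i.m i.K hd hL) 0), x ∈ Q c → x.shift κ ∈ Q c →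
        gaugeY i (g c) U κ x = fluct (kGeo i).eta (A c) κ x) →
      (∀ c, ∀ κ, ∀ x ∈ Q c, ‖A c κ x‖ ≤ C c * (ξ c)⁻¹) →
      (∀ c, ∀ μ ν, ∀ x ∈ Q c,
        ‖(((kGeo i).eta : ℂ)⁻¹) • covD (shiftsV1 (PV d ℓ i.m i.K hd hL)) (fun _ _ => (1 : (Matrix (Fin N) (Fin N) ℂ)ˣ)) μ (A c ν) x‖ ≤ C c * (ξ c ^ 2)⁻¹) →
      (∀ c, max (C c) (C c * (1 + D1 thetaProf)) * Λ c ^ 2 ≤ a₁) → (∀ c, max (C c) (C c * (1 + D1 thetaProf)) * Λ c ^ 2 ≤ 1 / 4) →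
    ∀ {B : B9.Backgrounds} (cfg : B.Cfg → CfgY (Matrix (Fin N) (Fin N) ℂ) i) (U₁ : B.Cfg), cfg U₁ = U →
      HasMajorant (g := toB6 (geo9K i) (Rr i) (Hp i)) (fun p : SiteY i × ι => ιB (blkOf i.D.toDomains p.1))
        (conj b ((etaS i ^ 2) • (GpY i (parKnitY i) U).restrictScalars ℝ))
        (fun a a' => K * (geo9K i).len a ^ 2 * Real.exp (-(δ * (geo9K i).dist a a'))) := by
  -- FILE 9 (the `G′` block at def-Y's letter) and the geometry at `r = δ_G`
  obtain ⟨δG, KG, M₉, T₉, N₉, hδG, hKG, a₉, ha₉, H9⟩ := eBlock_GpY_of_cubeData_unitary b hG Rr Hp hℓ hM₂ hrepr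
  obtain ⟨ML, d₁, d₂, d₃, d₄, d₅, Hgeo⟩ := geo_ladder (d := d) (ℓ := ℓ) (hd := hd) (hL := hL) (b₀ := b₀) (b₁ := b₁) Rr Hp hδG
  -- the constants `A_s = M₂Σ‖b‖K_G`, `Φ₁`, the size `a₀`
  obtain ⟨As, hAsdef⟩ : ∃ As : ℝ, As = M₂ * (∑ j, ‖b j‖) * KG := ⟨_, rfl⟩
  have hSb : 0 ≤ ∑ j, ‖b j‖ := Finset.sum_nonneg fun _ _ => norm_nonneg _
  have hAs : 0 ≤ As := by rw [hAsdef]; exact mul_nonneg (mul_nonneg hM₂ hSb) hKG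
  have hc₅ : 0 ≤ B6.c1 d₅ δG (1 / 2) := c1_nonneg _ _ _
  obtain ⟨Φ₁, hΦ₁def⟩ : ∃ Φ₁ : ℝ, Φ₁ = 32 * ((d : ℝ) + 1) ^ 2 * (M₂ * ∑ j, ‖b j‖) * As * B6.c1 d₅ δG (1 / 2) := ⟨_, rfl⟩
  have hΦ₁ : 0 ≤ Φ₁ := by rw [hΦ₁def]; positivity
  have ha₀ : (0 : ℝ) < 1 / (2 * (Φ₁ + 1)) := by positivity
  have hδ : (0 : ℝ) < (1 - 1 / 2) * δG := by linarith
  have hA : 0 ≤ 2 * As * B6.c1 d₅ δG (1 / 2) := by positivity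
  refine ⟨(1 - 1 / 2) * δG, 2 * As * B6.c1 d₅ δG (1 / 2), max M₉ ML, T₉, N₉, hδ, hA, a₉, ha₉, 1 / (2 * (Φ₁ + 1)), ha₀, ?_⟩
  intro α₀' hα ha₀' hα3 hα2
  have hs₁ : α₀' * Φ₁ ≤ 1 / 2 := small_of_le hΦ₁ ha₀'
  rw [hΦ₁def] at hs₁
  intro i hM hN hT hcf ιB hι U hU h52 g hu A Q C ξ Λ hC0 hξ hΛ hξS hΛξ hQ hgA hA' hdA hα₁ hα4 B cfg U₁ hcfg
  have hM₉ : M₉ ≤ ((ℓ : ℝ) + 1) * (toKT i).Mh := (le_max_left _ _).trans hM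
  have hML : ML ≤ (geo9K i).M := by
    rw [geo9K_M_eq' i]; exact (le_max_right _ _).trans hM
  -- FILE 9: the (3.42) block of `G′(U; parSymY)`; the geometry
  obtain ⟨hEG, -⟩ := H9 i hM₉ hN hT hcf ιB hι U hU g hu A Q C ξ Λ hC0 hξ hΛ hξS hΛξ hQ hgA hA' hdA hα₁ hα4 cfg U₁ hcfg
  obtain ⟨⟨htri, hrefl, hdnn⟩, -, -, ⟨h261J, h263J⟩, -⟩ := Hgeo i hML
  subst hcfg
  -- D1's READ: `conj b(η²G′_sym) ≺ A_s·ℓ²·e^{−δ_G d}`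
  have hGs := hasMajorant_conj_G_of_eBlockInv i b cfg (GpY i (parSymY i)) (parSymY i) (Rr := Rr i) (Hp := Hp i) hEG hKG ιB hι hM₂ hrepr rfl
    ((etaS i ^ 2) • (GpY i (parSymY i) (cfg U₁)).restrictScalars ℝ) (fun _ => rfl)
  rw [← hAsdef] at hGs
  -- junction file 9 in print's units
  exact hasMajorant_conj_GpY_parKnitY_print b i ιB (Rr := Rr i) (Hp := Hp i) hG hGa hU hα hα3 hα2 h52 hcf hM₂ hrepr d₅ hAs hδG.le htri hrefl hdnn
    h261J h263J hs₁ hGs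

end Literature.MathematicalPhysics.QuantumFieldTheory.Balaban1983to89.B9Thm31GpAtKnitLetterOfCubeData

end
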